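import Mathlib.GroupTheory.FreeGroup.Basic
import Mathlib.GroupTheory.SemidirectProduct
import Mathlib.GroupTheory.Index
import Mathlib.GroupTheory.OrderOfElement
import Mathlib.GroupTheory.QuotientGroup.Basic
import Mathlib.Data.ZMod.Basic
import Mathlib.Algebra.Group.TypeTags.Finite
import HarnessLib

/-!
# Stub `stub_centralizerFreeKernel` of line `finitary-ac-central-residue` for crux `CongruenceShadows.ShadowsStandard`
(item stmt-SmoothPoincare4-14593, route route-SmoothPoincare4-CongruenceShadows)

**Effective centrelessness in a free group.** Let `F` be free on a finite alphabet `ι`, let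
`R ⊴ F` contain two distinct letters `xₐ, x_b` and let `U ⊴ F` have finite index.  Then there is a
finite-index normal subgroup `V ≤ U` such that every `x ∈ F` commuting with `R` modulo `V` lies in
`U`.

The proof is elementary (a Magnus-type finite quotient).  Put `P := F ⧸ U` (finite) and
`N := P → ι → Multiplicative (ZMod 3)`, on which `P` acts by left translation of the `P`-argument
(`τ`); let `G := N ⋊[τ] P` and `μ : F →* G` the hom sending `x_j ↦ (δ_j, x̄_j)` with `δ_j` the
indicator of `(1, j)`.  Then `V := ker μ ≤ U` has finite index.  The `N`-component of `μ (x_j ^ n)`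
at coordinate `j` is the indicator of `{x̄_j ^ k : k < n}` (for `n ≤ ord x̄_j`) and is trivial at
the other coordinates.  If `μ x = (γ, σ)` commutes with `μ (xₐ ^ ord x̄ₐ) = (D, 1)` then `σ • D = D`,
which evaluated at `(σ, a)` forces `σ = x̄ₐ ^ s` with `s < ord x̄ₐ`; likewise `σ = x̄_b ^ t`.  Then
`u := xₐ ^ s * (x_b ^ t)⁻¹ ∈ R` has `μ u = (Γ, 1)` with `Γ(·, a)` the indicator of
`{x̄ₐ ^ k : k < s}` (the `b`-part does not touch coordinate `a ≠ b`), and `σ • Γ = Γ` at `(σ, a)`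
reads `[0 < s] = 0`, so `s = 0`, `σ = 1`, `x ∈ U`.

All auxiliary objects (`τ`, `δ`, `μ`) are introduced by existence lemmas and hypotheses, so the
file declares theorems only.
-/

-- the prescribed namespace `Summit.<P>.<Sub>.…` duplicates `SmoothPoincare4` (P = Sub)
set_option linter.dupNamespace false

noncomputable section

namespace Summit.SmoothPoincare4.SmoothPoincare4.Theorems.ShadowsStandard.FinitaryAcCentralResidue

open Subgroup

section Magnus

variable {P : Type} [Group P] {ι : Type}

/-- The left-translation action of `P` on `P → ι → Multiplicative (ZMod 3)` exists as a hom
`τ : P →* MulAut _` with `(τ σ f) q = f (σ⁻¹ * q)`. -/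
theorem exists_tau (P ι : Type) [Group P] :
    ∃ τ : P →* MulAut (P → ι → Multiplicative (ZMod 3)), ∀ σ f q, τ σ f q = f (σ⁻¹ * q) :=
  ⟨{ toFun := fun σ =>
      { toFun := fun f q => f (σ⁻¹ * q)
        invFun := fun f q => f (σ * q)
        left_inv := fun f => funext fun q => by simp only [inv_mul_cancel_left]
        right_inv := fun f => funext fun q => by simp only [mul_inv_cancel_left]
        map_mul' := fun _ _ => rfl }
     map_one' := MulEquiv.ext fun f => funext fun q => by
       show f (1⁻¹ * q) = f q
       rw [inv_one, one_mul]
     map_mul' := fun σ ρ => MulEquiv.ext fun f => funext fun q => by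
       show f ((σ * ρ)⁻¹ * q) = f (ρ⁻¹ * (σ⁻¹ * q))
       rw [mul_inv_rev, mul_assoc] },
    fun _ _ _ => rfl⟩

/-- The indicators `δ_j` of `(1, j) ∈ P × ι` exist. -/
theorem exists_delta (P ι : Type) [Group P] :
    ∃ δ : ι → P → ι → Multiplicative (ZMod 3),
      (∀ j, δ j 1 j = Multiplicative.ofAdd 1) ∧ ∀ j q i, ¬(q = 1 ∧ i = j) → δ j q i = 1 := by
  classical
  exact ⟨fun j q i => if q = 1 ∧ i = j then Multiplicative.ofAdd 1 else 1,
    fun j => if_pos ⟨rfl, rfl⟩, fun j q i h => if_neg h⟩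

/-- `1 ≠ 0` in `ZMod 3`, multiplicatively. -/
theorem ofAdd_one_ne_one : Multiplicative.ofAdd (1 : ZMod 3) ≠ 1 := by decide

variable {τ : P →* MulAut (P → ι → Multiplicative (ZMod 3))}

/-- In `N ⋊ P` with `N` commutative: if `g` has trivial `P`-component and commutes with `h`, then the
`N`-component of `g` is fixed by `h.right`. -/
theorem left_fixed_of_commute {g h : (P → ι → Multiplicative (ZMod 3)) ⋊[τ] P}
    (hc : g * h = h * g) (hg : g.right = 1) : τ h.right g.left = g.left := by
  have key := congrArg SemidirectProduct.left hc
  rw [SemidirectProduct.mul_left, SemidirectProduct.mul_left, hg, map_one, MulAut.one_apply,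
    mul_comm h.left] at key
  exact (mul_right_cancel key).symm

/-- If `[y, x] ∈ ker f` then `f y` and `f x` commute. -/
theorem map_comm_of_mem_ker {F G : Type} [Group F] [Group G] (f : F →* G) {y x : F}
    (h : y * x * y⁻¹ * x⁻¹ ∈ f.ker) : f y * f x = f x * f y := by
  rwa [MonoidHom.mem_ker, map_mul, map_mul, map_mul, map_inv, map_inv, mul_inv_eq_one,
    mul_inv_eq_iff_eq_mul] at h

variable {δ : ι → P → ι → Multiplicative (ZMod 3)} {π : FreeGroup ι →* P}
  {μ : FreeGroup ι →* (P → ι → Multiplicative (ZMod 3)) ⋊[τ] P}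

/-- The `N`-component of `μ x_j` is `δ_j`. -/
theorem mu_of_left (hμ : ∀ j, μ (FreeGroup.of j) = ⟨δ j, π (FreeGroup.of j)⟩) (j : ι) :
    (μ (FreeGroup.of j)).left = δ j := by
  rw [hμ]

/-- The `P`-component of `μ w` is `π w`. -/
theorem mu_right (hμ : ∀ j, μ (FreeGroup.of j) = ⟨δ j, π (FreeGroup.of j)⟩) (w : FreeGroup ι) :
    (μ w).right = π w := by
  have hcomp : SemidirectProduct.rightHom.comp μ = π :=
    FreeGroup.ext_hom _ _ fun j => by rw [MonoidHom.comp_apply, hμ]; rfl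
  change SemidirectProduct.rightHom (μ w) = π w
  rw [← MonoidHom.comp_apply, hcomp]

/-- `ker μ ≤ ker π`. -/
theorem ker_mu_le (hμ : ∀ j, μ (FreeGroup.of j) = ⟨δ j, π (FreeGroup.of j)⟩) : μ.ker ≤ π.ker := by
  intro w hw
  rw [MonoidHom.mem_ker] at hw ⊢
  rw [← mu_right hμ, hw, SemidirectProduct.one_right]

/-- The `P`-component of `μ (x_j ^ n)` is `x̄_j ^ n`. -/
theorem mu_pow_right (hμ : ∀ j, μ (FreeGroup.of j) = ⟨δ j, π (FreeGroup.of j)⟩) (j : ι) (n : ℕ) :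
    (μ (FreeGroup.of j ^ n)).right = π (FreeGroup.of j) ^ n := by
  rw [mu_right hμ, map_pow]

/-- One-step recursion for the `N`-component of `μ (x_j ^ n)`. -/
theorem mu_pow_succ_left (hτ : ∀ σ f q, τ σ f q = f (σ⁻¹ * q))
    (hμ : ∀ j, μ (FreeGroup.of j) = ⟨δ j, π (FreeGroup.of j)⟩) (j : ι) (n : ℕ) (q : P) (i : ι) :
    (μ (FreeGroup.of j ^ (n + 1))).left q i =
      (μ (FreeGroup.of j ^ n)).left q i * δ j ((π (FreeGroup.of j) ^ n)⁻¹ * q) i := by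
  rw [pow_succ, map_mul, SemidirectProduct.mul_left, mu_pow_right hμ, mu_of_left hμ,
    Pi.mul_apply, Pi.mul_apply, hτ]

/-- (E2) The `N`-component of `μ (x_j ^ n)` is trivial at every coordinate `i ≠ j`. -/
theorem mu_pow_left_of_ne (hτ : ∀ σ f q, τ σ f q = f (σ⁻¹ * q))
    (hμ : ∀ j, μ (FreeGroup.of j) = ⟨δ j, π (FreeGroup.of j)⟩)
    (hδ0 : ∀ j q i, ¬(q = 1 ∧ i = j) → δ j q i = 1) {i j : ι} (h : i ≠ j) (n : ℕ) (q : P) :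
    (μ (FreeGroup.of j ^ n)).left q i = 1 := by
  induction n with
  | zero => rw [pow_zero, map_one]; rfl
  | succ n ih => rw [mu_pow_succ_left hτ hμ, ih, hδ0 j _ i (fun hc => h hc.2), one_mul]

/-- (E1, vanishing) The `N`-component of `μ (x_j ^ n)` at `(q, j)` is trivial when no power
`x̄_j ^ k`, `k < n`, equals `q`. -/
theorem mu_pow_left_self_of_forall (hτ : ∀ σ f q, τ σ f q = f (σ⁻¹ * q))
    (hμ : ∀ j, μ (FreeGroup.of j) = ⟨δ j, π (FreeGroup.of j)⟩)
    (hδ0 : ∀ j q i, ¬(q = 1 ∧ i = j) → δ j q i = 1) (j : ι) (n : ℕ) (q : P)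
    (h : ∀ k < n, π (FreeGroup.of j) ^ k ≠ q) : (μ (FreeGroup.of j ^ n)).left q j = 1 := by
  induction n with
  | zero => rw [pow_zero, map_one]; rfl
  | succ n ih =>
    rw [mu_pow_succ_left hτ hμ, ih (fun k hk => h k (Nat.lt_succ_of_lt hk)), one_mul]
    exact hδ0 j _ j fun hc => h n (Nat.lt_succ_self n) (inv_mul_eq_one.mp hc.1)

/-- (E1, nonvanishing) For `n ≤ ord x̄_j`, the `N`-component of `μ (x_j ^ n)` at `(q, j)` is the
generator of `ZMod 3` when some power `x̄_j ^ k`, `k < n`, equals `q`. -/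
theorem mu_pow_left_self_of_exists (hτ : ∀ σ f q, τ σ f q = f (σ⁻¹ * q))
    (hμ : ∀ j, μ (FreeGroup.of j) = ⟨δ j, π (FreeGroup.of j)⟩)
    (hδ1 : ∀ j, δ j 1 j = Multiplicative.ofAdd 1)
    (hδ0 : ∀ j q i, ¬(q = 1 ∧ i = j) → δ j q i = 1) (j : ι) {n : ℕ}
    (hn : n ≤ orderOf (π (FreeGroup.of j))) (q : P) (h : ∃ k < n, π (FreeGroup.of j) ^ k = q) :
    (μ (FreeGroup.of j ^ n)).left q j = Multiplicative.ofAdd 1 := by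
  induction n with
  | zero =>
    obtain ⟨k, hk, _⟩ := h
    exact absurd hk (Nat.not_lt_zero k)
  | succ n ih =>
    rw [mu_pow_succ_left hτ hμ]
    by_cases hq : π (FreeGroup.of j) ^ n = q
    · have hlt : ∀ k < n, π (FreeGroup.of j) ^ k ≠ q := by
        intro k hk heq
        have hkn : k = n :=
          pow_injOn_Iio_orderOf (x := π (FreeGroup.of j))
            (show k ∈ Set.Iio _ from lt_of_lt_of_le (hk.trans n.lt_succ_self) hn)
            (show n ∈ Set.Iio _ from lt_of_lt_of_le n.lt_succ_self hn) (heq.trans hq.symm)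
        exact absurd hkn hk.ne
      rw [mu_pow_left_self_of_forall hτ hμ hδ0 j n q hlt, one_mul, ← hq, inv_mul_cancel, hδ1]
    · obtain ⟨k, hk, hkq⟩ := h
      have hkn : k ≠ n := fun hkn => hq (hkn ▸ hkq)
      have hk' : k < n := lt_of_le_of_ne (Nat.lt_succ_iff.mp hk) hkn
      rw [ih (le_of_lt (lt_of_lt_of_le n.lt_succ_self hn)) ⟨k, hk', hkq⟩,
        hδ0 j _ j (fun hc => hq (inv_mul_eq_one.mp hc.1)), mul_one]

/-- The heart of the matter: if `μ x` commutes with `μ R`, where `R` contains two distinct letters,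
then `π x = 1`. -/
theorem apply_eq_one_of_commute [Finite P] (hτ : ∀ σ f q, τ σ f q = f (σ⁻¹ * q))
    (hμ : ∀ j, μ (FreeGroup.of j) = ⟨δ j, π (FreeGroup.of j)⟩)
    (hδ1 : ∀ j, δ j 1 j = Multiplicative.ofAdd 1)
    (hδ0 : ∀ j q i, ¬(q = 1 ∧ i = j) → δ j q i = 1) {R : Subgroup (FreeGroup ι)} {a b : ι}
    (hab : a ≠ b) (ha : FreeGroup.of a ∈ R) (hb : FreeGroup.of b ∈ R) (x : FreeGroup ι)
    (H : ∀ y ∈ R, μ y * μ x = μ x * μ y) : π x = 1 := by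
  have hxr : (μ x).right = π x := mu_right hμ x
  -- steps (3)/(4): `π x` is a power `x̄_c ^ s`, `s < ord x̄_c`, for every letter `c ∈ R`
  have step : ∀ c : ι, FreeGroup.of c ∈ R →
      ∃ s, s < orderOf (π (FreeGroup.of c)) ∧ π (FreeGroup.of c) ^ s = π x := by
    intro c hc
    have he : 0 < orderOf (π (FreeGroup.of c)) := orderOf_pos _
    have hcomm := H _ (R.pow_mem hc (orderOf (π (FreeGroup.of c))))
    have hright : (μ (FreeGroup.of c ^ orderOf (π (FreeGroup.of c)))).right = 1 := by
      rw [mu_pow_right hμ, pow_orderOf_eq_one]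
    have key := congr_fun (congr_fun (left_fixed_of_commute hcomm hright) (π x)) c
    rw [hτ, hxr, inv_mul_cancel,
      mu_pow_left_self_of_exists hτ hμ hδ1 hδ0 c le_rfl 1 ⟨0, he, pow_zero _⟩] at key
    by_contra hne
    push Not at hne
    rw [mu_pow_left_self_of_forall hτ hμ hδ0 c _ (π x) hne] at key
    exact ofAdd_one_ne_one key
  obtain ⟨s, hs, hsa⟩ := step a ha
  obtain ⟨t, _ht, htb⟩ := step b hb
  -- step (5): `u := xₐ ^ s * (x_b ^ t)⁻¹ ∈ R` has trivial `P`-component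
  have hu : FreeGroup.of a ^ s * (FreeGroup.of b ^ t)⁻¹ ∈ R :=
    R.mul_mem (R.pow_mem ha s) (R.inv_mem (R.pow_mem hb t))
  have hcomm := H _ hu
  have hright : (μ (FreeGroup.of a ^ s * (FreeGroup.of b ^ t)⁻¹)).right = 1 := by
    rw [mu_right hμ, map_mul, map_inv, map_pow, map_pow, hsa, htb, mul_inv_cancel]
  have key := congr_fun (congr_fun (left_fixed_of_commute hcomm hright) (π x)) a
  -- the `a`-coordinate of `μ u` is that of `μ (xₐ ^ s)` (here `a ≠ b` is used)
  have hΓ : ∀ q, (μ (FreeGroup.of a ^ s * (FreeGroup.of b ^ t)⁻¹)).left q a =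
      (μ (FreeGroup.of a ^ s)).left q a := by
    intro q
    rw [map_mul, map_inv, SemidirectProduct.mul_left, Pi.mul_apply, Pi.mul_apply, hτ,
      SemidirectProduct.inv_left, hτ, Pi.inv_apply, Pi.inv_apply,
      mu_pow_left_of_ne hτ hμ hδ0 hab, inv_one, mul_one]
  rw [hτ, hxr, inv_mul_cancel, hΓ, hΓ] at key
  have hne : ∀ k < s, π (FreeGroup.of a) ^ k ≠ π x := by
    intro k hk heq
    rw [← hsa] at heq
    have hks : k = s :=
      pow_injOn_Iio_orderOf (x := π (FreeGroup.of a)) (show k ∈ Set.Iio _ from hk.trans hs)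
        (show s ∈ Set.Iio _ from hs) heq
    exact absurd hks hk.ne
  rw [mu_pow_left_self_of_forall hτ hμ hδ0 a s (π x) hne] at key
  rcases Nat.eq_zero_or_pos s with h0 | hpos
  · rw [← hsa, h0, pow_zero]
  · rw [mu_pow_left_self_of_exists hτ hμ hδ1 hδ0 a hs.le 1 ⟨0, hpos, pow_zero _⟩] at key
    exact absurd key ofAdd_one_ne_one

end Magnus

/-- **Effective centrelessness in a free group.** In a free group `F` on a finite alphabet, let
`R ⊴ F` contain two distinct letters `xₐ, x_b` and let `U ⊴ F` have finite index.  Then there is a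
finite-index normal subgroup `V ≤ U` such that every `x ∈ F` commuting with `R` modulo `V` lies in
`U`.  (Take `V := ker μ` for the Magnus map `μ : F →* (F ⧸ U → ι → ZMod 3) ⋊ (F ⧸ U)`,
`x_j ↦ (δ_j, x̄_j)`.) -/
theorem stub_centralizerFreeKernel :
    ∀ {ι : Type} [Fintype ι] [DecidableEq ι] (R U : Subgroup (FreeGroup ι)) [R.Normal] [U.Normal]
      [U.FiniteIndex] (a b : ι), a ≠ b → FreeGroup.of a ∈ R → FreeGroup.of b ∈ R →
      ∃ V : Subgroup (FreeGroup ι), V.Normal ∧ V.FiniteIndex ∧ V ≤ U ∧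
        ∀ x : FreeGroup ι, (∀ y ∈ R, y * x * y⁻¹ * x⁻¹ ∈ V) → x ∈ U := by
  intro ι _ _ R U _ _ _ a b hab ha hb
  obtain ⟨τ, hτ⟩ := exists_tau (FreeGroup ι ⧸ U) ι
  obtain ⟨δ, hδ1, hδ0⟩ := exists_delta (FreeGroup ι ⧸ U) ι
  obtain ⟨μ, hμ⟩ :
      ∃ μ : FreeGroup ι →* ((FreeGroup ι ⧸ U) → ι → Multiplicative (ZMod 3)) ⋊[τ] (FreeGroup ι ⧸ U),
        ∀ j, μ (FreeGroup.of j) = ⟨δ j, QuotientGroup.mk' U (FreeGroup.of j)⟩ :=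
    ⟨FreeGroup.lift fun j => ⟨δ j, QuotientGroup.mk' U (FreeGroup.of j)⟩,
      fun j => FreeGroup.lift_apply_of⟩
  haveI : Finite (((FreeGroup ι ⧸ U) → ι → Multiplicative (ZMod 3)) ⋊[τ] (FreeGroup ι ⧸ U)) :=
    Finite.of_equiv _ SemidirectProduct.equivProd.symm
  refine ⟨μ.ker, inferInstance, inferInstance, ?_, ?_⟩
  · exact (ker_mu_le hμ).trans (QuotientGroup.ker_mk' U).le
  · intro x hx
    have h1 := apply_eq_one_of_commute hτ hμ hδ1 hδ0 hab ha hb x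
      (fun y hy => map_comm_of_mem_ker μ (hx y hy))
    rwa [QuotientGroup.mk'_apply, QuotientGroup.eq_one_iff] at h1

end Summit.SmoothPoincare4.SmoothPoincare4.Theorems.ShadowsStandard.FinitaryAcCentralResidue

end
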